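import Summits.FinalStateConjecture.FinalStateConjecture.Theorems.ChannelsResolveTameDevelopmentsR.Negative.SubMinkowskiCompleteness
import Literature.Geometry.Lorentzian.KerrConvergenceProofs
import Literature.Geometry.Lorentzian.CausalityPushUp
import HarnessLib

/-!
# Φ WITHOUT `IsMaximal` HOLDS on the flat model class: a sojourn-complete open sub-development of
# Minkowski space settles (honest exhaustive `N = 0` decomposition) — support for the crux
# `ChannelsResolveTameDevelopmentsR` (K2R ≡ Φ, item `stmt-FinalStateConjecture-14075`, route
# PhotonSphereChannels), load-bearing analysis on the certifiable model class, part 3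

Part 2 (`SubMinkowskiCompleteness`) showed: for the open sub-development `η|_U` of the trivial datum,
complete `𝓘⁺` ⟺ `{x⁰ ≥ 0} ⊆ U`. Here: if `{x⁰ ≥ 0} ⊆ U` then `η|_U` SATISFIES THE CONCLUSION OF Φ — the
future half-space `O = {x⁰ ≥ 0}` carries the honest exhaustive `N = 0` final-state `2`-decomposition by
the inclusion chart of `{x⁰ > 0}` after `τ₀ = 1` (`subDecomp`: zero deviation; `O` is the self-determined
exterior `J⁺(ι ℝ³) ∩ I⁻(charted)` of `η|_U`, `futureSet_eq_exteriorOf`; the chart exhausts `O` by vertical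
segments, `hasExhaustiveCharts_subDecomp`; all causal relations computed INSIDE `U`, by lifting straight
segments of the half-space, `isFutureCausalCurveOn_lift`). Hence:

* `settles_of_hasCompleteNullInfinity` — **every sojourn-complete member of the flat model class
  (`subDev U …`, maximal or not) admits an honest exhaustive final-state decomposition**: the
  hypothesis-mutated statement "Φ without `IsMaximal`" (`Disproof.TameResolutionWithoutMaximal` of the
  crux) is TRUE on the certifiable class — indeed from completeness ALONE, (i) and (ii) idle as well —
  whereas "Φ without `IsMaximal` and without complete `𝓘⁺`" is false there
  (`SlabMinkowskiLoadBearing.not_tameResolution_allDevelopments`). On the models the tree can certify,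
  complete `𝓘⁺` is exactly the load-bearing structural hypothesis of K2R ≡ Φ and maximality is idle; a
  line that USES `IsMaximal` essentially must do so through genuinely dynamical (non-flat) information.

All results proved; no named facts.

## References

* D. Christodoulou, S. Klainerman, *The global nonlinear stability of the Minkowski space* (1993),
  Thm. 1.0.2 (Minkowski space is its own final state).
* M. Dafermos, J. Luk, arXiv:1710.01722, Conjecture 1 (exterior region, exhaustion).
* B. O'Neill, *Semi-Riemannian geometry* (1983), Ch. 14, p. 402 (causal relations of `ℝ⁴₁`).
-/

noncomputable section

open Bundle Set Function Filter TopologicalSpace Topology MeasureTheory Metric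
open scoped Manifold ContDiff Topology ENNReal

set_option linter.dupNamespace false

namespace Summit.FinalStateConjecture.FinalStateConjecture.Theorems.ChannelsResolveTameDevelopmentsR.SubMinkowski

open Literature.Geometry.Lorentzian Literature.Geometry.Lorentzian.Minkowski

/-! ### Lifting curves of Minkowski space lying in `U` -/

section Lift

variable {U : Opens E4}

open Classical in
/-- The lift to `U` of an ambient curve (junk value `z` where the curve leaves `U`) agrees with the curve
wherever the curve is in `U`. -/
theorem lift_val {ℓ : ℝ → E4} {z : U} {σ : ℝ} (hσ : ℓ σ ∈ (U : Set E4)) :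
    ((if h : ℓ σ ∈ (U : Set E4) then (⟨ℓ σ, h⟩ : U) else z : U) : E4) = ℓ σ := by
  rw [dif_pos hσ]

open Classical in
/-- **A future causal curve of Minkowski space lying in `U` along `s` lifts to a future causal curve of
`η|_U` on `s`** (the lift is the curve near every parameter of `s`, `U` being open; same velocity).
O'Neill 1983, Ch. 1, pp. 3–7. -/
theorem isFutureCausalCurveOn_lift {ℓ : ℝ → E4} (hℓc : Continuous ℓ) {s : Set ℝ}
    (hℓ : spacetime.metric.IsFutureCausalCurveOn spacetime.timeOrientation ℓ s)
    (hs : ∀ σ ∈ s, ℓ σ ∈ (U : Set E4)) (z : U) :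
    (subMetric U).IsFutureCausalCurveOn (subOrientation U)
      (fun σ ↦ if h : ℓ σ ∈ (U : Set E4) then (⟨ℓ σ, h⟩ : U) else z) s := by
  refine isFutureCausalCurveOn_restrict_iff.2 fun σ hσ ↦ ?_
  have hev : (Subtype.val ∘ fun σ ↦ if h : ℓ σ ∈ (U : Set E4) then (⟨ℓ σ, h⟩ : U) else z) =ᶠ[𝓝 σ] ℓ := by
    filter_upwards [hℓc.continuousAt.preimage_mem_nhds (U.isOpen.mem_nhds (hs σ hσ))] with σ' hσ'
    exact lift_val hσ'
  obtain ⟨hd, hfd⟩ := hℓ σ hσ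
  have hveq : velocity 𝓘(ℝ, E4) (Subtype.val ∘ fun σ ↦ if h : ℓ σ ∈ (U : Set E4) then (⟨ℓ σ, h⟩ : U)
      else z) σ = velocity 𝓘(ℝ, E4) ℓ σ := DFunLike.congr_fun hev.mfderiv_eq (1 : ℝ)
  exact ⟨hev.mdifferentiableAt_iff.2 hd, hveq ▸ hfd⟩

open Classical in
/-- **A future timelike curve of Minkowski space lying in `U` along `s` lifts to a future timelike curve
of `η|_U` on `s`.** O'Neill 1983, Ch. 1, pp. 3–7. -/
theorem isFutureTimelikeCurveOn_lift {ℓ : ℝ → E4} (hℓc : Continuous ℓ) {s : Set ℝ}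
    (hℓ : spacetime.metric.IsFutureTimelikeCurveOn spacetime.timeOrientation ℓ s)
    (hs : ∀ σ ∈ s, ℓ σ ∈ (U : Set E4)) (z : U) :
    (subMetric U).IsFutureTimelikeCurveOn (subOrientation U)
      (fun σ ↦ if h : ℓ σ ∈ (U : Set E4) then (⟨ℓ σ, h⟩ : U) else z) s := by
  refine (LorentzianMetric.isFutureTimelikeCurveOn_restrict_iff _ _ _ _ _).2 fun σ hσ ↦ ?_
  have hev : (Subtype.val ∘ fun σ ↦ if h : ℓ σ ∈ (U : Set E4) then (⟨ℓ σ, h⟩ : U) else z) =ᶠ[𝓝 σ] ℓ := by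
    filter_upwards [hℓc.continuousAt.preimage_mem_nhds (U.isOpen.mem_nhds (hs σ hσ))] with σ' hσ'
    exact lift_val hσ'
  obtain ⟨hd, h1, h2⟩ := hℓ σ hσ
  have hveq : velocity 𝓘(ℝ, E4) (Subtype.val ∘ fun σ ↦ if h : ℓ σ ∈ (U : Set E4) then (⟨ℓ σ, h⟩ : U)
      else z) σ = velocity 𝓘(ℝ, E4) ℓ σ := DFunLike.congr_fun hev.mfderiv_eq (1 : ℝ)
  exact ⟨hev.mdifferentiableAt_iff.2 hd, hveq ▸ h1, hveq ▸ h2⟩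

end Lift

/-! ### Causal relations of `η|_U` above the slice, when `{x⁰ ≥ 0} ⊆ U` -/

section Causal

variable {U : Opens E4} {hsl : ∀ y : slice, sliceEmbed y ∈ U}

/-- A point of `η|_U` in the causal future (within `U`) of the slice has `x⁰ ≥ 0`. -/
theorem time_nonneg_of_mem_causalFuture_range {x : U}
    (hx : x ∈ (subMetric U).causalFuture (subOrientation U)
      (range (vacuumCauchyDevelopment.embedOpens U hsl))) : 0 ≤ (x : E4) 0 := by
  rw [← image_univ] at hx
  obtain ⟨p, -, hp⟩ := exists_norm_spatial_sub_le_of_mem_causalFuture hx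
  exact (norm_nonneg _).trans hp

variable (hfut : {x : E4 | 0 ≤ x 0} ⊆ (U : Set E4))
include hfut

open Classical in
/-- If `{x⁰ ≥ 0} ⊆ U`, every point of `U` with `x⁰ ≥ 0` is in the causal future (within `U`) of the slice:
the straight causal segment from `(0, x̲)` to `x` lies in `{x⁰ ≥ 0} ⊆ U` and lifts. O'Neill 1983, Ch. 14,
p. 402. -/
theorem mem_causalFuture_range_of_time_nonneg {x : U} (hx : 0 ≤ (x : E4) 0) :
    x ∈ (subMetric U).causalFuture (subOrientation U) (range (vacuumCauchyDevelopment.embedOpens U hsl)) := by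
  set p : E4 := E4.ofTimeSpace 0 (E4.spatial (x : E4)) with hp
  have hpU : p ∈ (U : Set E4) := hsl ⟨E4.spatial (x : E4), mem_slice _⟩
  have hpemb : (⟨p, hpU⟩ : U) = vacuumCauchyDevelopment.embedOpens U hsl ⟨E4.spatial (x : E4), mem_slice _⟩ :=
    rfl
  by_cases hxp : (x : E4) = p
  · refine Or.inl ⟨⟨E4.spatial (x : E4), mem_slice _⟩, ?_⟩
    rw [← hpemb]
    exact Subtype.ext hxp.symm
  · -- the straight causal segment from `p` to `x`, lifted to `U`
    set ℓ : ℝ → E4 := fun σ ↦ p + σ • ((x : E4) - p) with hℓ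
    have hℓc : Continuous ℓ := continuous_const.add (continuous_id.smul continuous_const)
    have hcone : ‖E4.spatial (x : E4) - E4.spatial p‖ ≤ (x : E4) 0 - p 0 := by
      rw [hp, E4.spatial_ofTimeSpace, sub_self, norm_zero, E4.ofTimeSpace_apply_zero, sub_zero]
      exact hx
    have hℓM : spacetime.metric.IsFutureCausalCurveOn spacetime.timeOrientation ℓ (Icc 0 1) :=
      isFutureCausalCurveOn_segment hcone hxp _
    have hs : ∀ σ ∈ Icc (0 : ℝ) 1, ℓ σ ∈ (U : Set E4) := fun σ hσ ↦ hfut (by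
      show 0 ≤ (p + σ • ((x : E4) - p)) 0
      have : (p + σ • ((x : E4) - p)) 0 = σ * (x : E4) 0 := by simp [hp]
      rw [this]
      exact mul_nonneg hσ.1 hx)
    refine Or.inr ⟨⟨p, hpU⟩, ⟨⟨E4.spatial (x : E4), mem_slice _⟩, hpemb.symm⟩,
      fun σ ↦ if h : ℓ σ ∈ (U : Set E4) then (⟨ℓ σ, h⟩ : U) else x, 0, 1, zero_lt_one,
      isFutureCausalCurveOn_lift hℓc hℓM hs x, ?_, ?_⟩
    · apply Subtype.ext
      rw [lift_val (hs 0 ⟨le_rfl, zero_le_one⟩)]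
      simp [hℓ]
    · apply Subtype.ext
      rw [lift_val (hs 1 ⟨zero_le_one, le_rfl⟩)]
      simp [hℓ]

open Classical in
/-- If `{x⁰ ≥ 0} ⊆ U`, every point of `U` with `x⁰ ≥ 0` is in the chronological past (within `U`) of the
late half-space `{x⁰ > T}`: the vertical timelike segment from `x` to `x + (|T| + 1)∂₀` lies in
`{x⁰ ≥ 0} ⊆ U` and lifts. O'Neill 1983, Ch. 14, p. 402. -/
theorem mem_chronologicalPast_late_of_time_nonneg {x : U} (hx : 0 ≤ (x : E4) 0) (T : ℝ) :
    x ∈ (subMetric U).chronologicalPast (subOrientation U) {z : U | T < (z : E4) 0} := by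
  set s : ℝ := |T| + 1 with hs_def
  have hs : 0 < s := by positivity
  set w : E4 := s • E4.basisVector 0 with hw
  have hw0 : w 0 = s := by simp [hw]
  have hws : ‖E4.spatial w‖ < w 0 := by
    rw [hw, map_smul, C0Extension.spatial_basisVector_zero, smul_zero, norm_zero, ← hw, hw0]
    exact hs
  set ℓ : ℝ → E4 := fun σ ↦ (x : E4) + σ • w with hℓ
  have hℓc : Continuous ℓ := continuous_const.add (continuous_id.smul continuous_const)
  have hℓM : spacetime.metric.IsFutureTimelikeCurveOn spacetime.timeOrientation ℓ (Icc 0 1) :=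
    isFutureTimelikeCurveOn_line hws _
  have htime : ∀ σ, ℓ σ 0 = (x : E4) 0 + σ * s := fun σ ↦ by simp [hℓ, hw]
  have hmem : ∀ σ ∈ Icc (0 : ℝ) 1, ℓ σ ∈ (U : Set E4) := fun σ hσ ↦ hfut (by
    show 0 ≤ ℓ σ 0
    rw [htime]
    nlinarith [hσ.1])
  -- the endpoint `y = ℓ 1 ∈ {x⁰ > T}` is in `I⁺(x)` within `U`
  set c : ℝ → U := fun σ ↦ if h : ℓ σ ∈ (U : Set E4) then (⟨ℓ σ, h⟩ : U) else x with hc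
  have hc0 : c 0 = x := Subtype.ext (by rw [hc, lift_val (hmem 0 ⟨le_rfl, zero_le_one⟩)]; simp [hℓ])
  have hy : c 1 ∈ {z : U | T < (z : E4) 0} := by
    show T < ((c 1 : U) : E4) 0
    rw [hc, lift_val (hmem 1 ⟨zero_le_one, le_rfl⟩), htime, one_mul, hs_def]
    linarith [le_abs_self T]
  have h1 : c 1 ∈ (subMetric U).chronologicalFuture (subOrientation U) {x} :=
    ⟨x, rfl, c, 0, 1, zero_lt_one, isFutureTimelikeCurveOn_lift hℓc hℓM hmem x, hc0, rfl⟩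
  exact LorentzianMetric.chronologicalFuture_mono (singleton_subset_iff.mpr hy)
    (LorentzianMetric.mem_chronologicalPast_of_mem_chronologicalFuture h1)

open Classical in
/-- If `{x⁰ ≥ 0} ⊆ U`, a point of `U` with `0 ≤ x⁰ ≤ T` is in the causal past (within `U`) of the slab
`{x⁰ = T}`: the vertical causal segment from `x` to `(T, x̲)` lies in `{x⁰ ≥ 0} ⊆ U` and lifts.
O'Neill 1983, Ch. 14, p. 402. -/
theorem mem_causalPast_slab_of_time_le {x : U} (hx : 0 ≤ (x : E4) 0) {T : ℝ} (hxT : (x : E4) 0 ≤ T) :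
    x ∈ (subMetric U).causalPast (subOrientation U) {z : U | (z : E4) 0 = T} := by
  rcases hxT.eq_or_lt with heq | hlt
  · exact LorentzianMetric.subset_causalPast _ _ _ heq
  · set q : E4 := (x : E4) + (T - (x : E4) 0) • E4.basisVector 0 with hq
    have hq0 : q 0 = T := by simp [hq]
    have hqs : E4.spatial q = E4.spatial (x : E4) := by
      rw [hq, map_add, map_smul, C0Extension.spatial_basisVector_zero, smul_zero, add_zero]
    have hqx : q ≠ (x : E4) := fun h ↦ by
      have := congrArg (fun u : E4 ↦ u 0) h
      rw [hq0] at this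
      linarith
    set ℓ : ℝ → E4 := fun σ ↦ (x : E4) + σ • (q - (x : E4)) with hℓ
    have hℓc : Continuous ℓ := continuous_const.add (continuous_id.smul continuous_const)
    have hcone : ‖E4.spatial q - E4.spatial (x : E4)‖ ≤ q 0 - (x : E4) 0 := by
      rw [hqs, sub_self, norm_zero, hq0]; linarith
    have hℓM : spacetime.metric.IsFutureCausalCurveOn spacetime.timeOrientation ℓ (Icc 0 1) :=
      isFutureCausalCurveOn_segment hcone hqx _
    have htime : ∀ σ, ℓ σ 0 = (x : E4) 0 + σ * (T - (x : E4) 0) := fun σ ↦ by simp [hℓ, hq]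
    have hmem : ∀ σ ∈ Icc (0 : ℝ) 1, ℓ σ ∈ (U : Set E4) := fun σ hσ ↦ hfut (by
      show 0 ≤ ℓ σ 0
      rw [htime]
      nlinarith [hσ.1])
    set c : ℝ → U := fun σ ↦ if h : ℓ σ ∈ (U : Set E4) then (⟨ℓ σ, h⟩ : U) else x with hc
    have hc0 : c 0 = x := Subtype.ext (by rw [hc, lift_val (hmem 0 ⟨le_rfl, zero_le_one⟩)]; simp [hℓ])
    have hc1 : c 1 ∈ {z : U | (z : E4) 0 = T} := by
      show ((c 1 : U) : E4) 0 = T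
      rw [hc, lift_val (hmem 1 ⟨zero_le_one, le_rfl⟩), htime]
      ring
    have h1 : c 1 ∈ (subMetric U).causalFuture (subOrientation U) {x} :=
      Or.inr ⟨x, rfl, c, 0, 1, zero_lt_one, isFutureCausalCurveOn_lift hℓc hℓM hmem x, hc0, rfl⟩
    exact LorentzianMetric.causalFuture_mono (singleton_subset_iff.mpr hc1)
      (LorentzianMetric.mem_causalPast_of_mem_causalFuture h1)

end Causal

/-! ### The honest `N = 0` decomposition of the future half-space of `η|_U` -/

/-- The open late half-space `{x⁰ > 0}`, the domain of the flat chart. -/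
def flatDom : Opens E4 :=
  ⟨{x : E4 | 0 < x 0}, isOpen_lt continuous_const (EuclideanSpace.proj (0 : Fin 4)).continuous⟩

/-- Membership in `flatDom` is `0 < x⁰`. -/
@[simp] theorem mem_flatDom {x : E4} : x ∈ flatDom ↔ 0 < x 0 := Iff.rfl

/-- The closed future half-space `O = {x⁰ ≥ 0}` of `U` (a set of points of `U`). -/
def futureSet (U : Opens E4) : Set U := {x | 0 ≤ (x : E4) 0}

section Decomposition

variable {U : Opens E4} {hU : IsConnected (U : Set E4)} {hsl : ∀ y : slice, sliceEmbed y ∈ U}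
  {hC : (subMetric U).IsCauchyHypersurface (subOrientation U)
    (range (vacuumCauchyDevelopment.embedOpens U hsl))}
  (hfut : {x : E4 | 0 ≤ x 0} ⊆ (U : Set E4))

/-- If `{x⁰ ≥ 0} ⊆ U` then `{x⁰ > 0} ≤ U`. -/
theorem flatDom_le (hfut : {x : E4 | 0 ≤ x 0} ⊆ (U : Set E4)) : flatDom ≤ U :=
  fun x hx ↦ hfut (show (0 : ℝ) ≤ x 0 from le_of_lt hx)

/-- The inclusion chart `{x⁰ > 0} ↪ U` has vanishing deviation from `η` (its differential is the
identity, `OpensChart.mfderiv_inclusion_apply`). -/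
theorem deviationExtend_inclusion (hfut : {x : E4 | 0 ≤ x 0} ⊆ (U : Set E4)) :
    (subDev U hU hsl hC).toSpacetime.deviationExtend (Minkowski.backgroundOn flatDom)
      (Opens.inclusion (flatDom_le hfut)) = 0 := by
  funext y
  by_cases hy : y ∈ flatDom
  · have h := (subDev U hU hsl hC).toSpacetime.deviationExtend_coe (Minkowski.backgroundOn flatDom)
      (Opens.inclusion (flatDom_le hfut)) ⟨y, hy⟩
    rw [h]
    ext v w
    change bilin (mfderiv 𝓘(ℝ, E4) (𝓡 4) (Opens.inclusion (flatDom_le hfut)) ⟨y, hy⟩ v)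
        (mfderiv 𝓘(ℝ, E4) (𝓡 4) (Opens.inclusion (flatDom_le hfut)) ⟨y, hy⟩ w) - bilin v w = 0
    rw [OpensChart.mfderiv_inclusion_apply, OpensChart.mfderiv_inclusion_apply, sub_self]
  · have h : ¬ ∃ a : flatDom, (a : E4) = y := fun ⟨a, ha⟩ ↦ hy (ha ▸ a.2)
    exact Function.extend_apply' _ _ _ h

/-- **The honest `N = 0` final-state decomposition of the future half-space `O = {x⁰ ≥ 0}` of `η|_U`**
(when `{x⁰ ≥ 0} ⊆ U`): no hole, `τ₀ = 1`, flat domain `{x⁰ > 0}`, flat chart the inclusion into `U`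
(deviation `0`); the covering clause holds because a point of `O` not later than `1` lies in the causal
past, within `U`, of the initial flat slab `{x⁰ = 1}` (`mem_causalPast_slab_of_time_le`).
Christodoulou–Klainerman 1993, Thm. 1.0.2; pattern of `UniversalWitnessFamily/Negative/MinkowskiSettled`. -/
def subDecomp (hfut : {x : E4 | 0 ≤ x 0} ⊆ (U : Set E4)) :
    FinalStateDecomposition (subDev U hU hsl hC).toSpacetime (futureSet U) 2 where
  N := 0
  mass := Fin.elim0
  spin := Fin.elim0
  mass_pos i := i.elim0
  abs_spin_le_mass i := i.elim0
  motion := Fin.elim0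
  τ₀ := 1
  chart i := i.elim0
  isLateChart i := i.elim0
  tendsto_truncDeviationCk i := i.elim0
  exists_pairwise_disjoint _ := ⟨0, fun i ↦ i.elim0⟩
  excision := Fin.elim0
  tendsto_excision_div i := i.elim0
  flatDomain := flatDom
  setOf_lt_excision_subset_flatDomain x hx := (zero_lt_one.trans hx.1 : (0 : ℝ) < x 0)
  flatChart := Opens.inclusion (flatDom_le hfut)
  isLateChart_flat := by
    refine ⟨contMDiff_inclusion (flatDom_le hfut), ?_, ?_⟩
    · have hlate : IsOpen ((Minkowski.backgroundOn flatDom).lateRegion 1) :=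
        isOpen_lt continuous_const ((PiLp.continuous_apply 2 _ 0).comp continuous_subtype_val)
      exact (Opens.isOpenEmbedding_of_le (flatDom_le hfut)).comp (IsOpen.isOpenEmbedding_subtypeVal hlate)
    · rintro _ ⟨y, hy, rfl⟩
      show (0 : ℝ) ≤ (y : E4) 0
      exact zero_le_one.trans (le_of_lt hy)
  tendsto_deviationCk_flat := by
    have h : ∀ τ, (subDev U hU hsl hC).toSpacetime.deviationCk (Minkowski.backgroundOn flatDom)
        (Opens.inclusion (flatDom_le hfut)) 2 τ = 0 := fun τ ↦ by
      rw [Spacetime.deviationCk, deviationExtend_inclusion hfut, supCkENorm_zero]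
    exact tendsto_const_nhds.congr fun τ ↦ (h τ).symm
  diff_subset_causalPast := by
    intro x hx
    change U at x
    have hx0 : (0 : ℝ) ≤ (x : E4) 0 := hx.1
    have hxle : (x : E4) 0 ≤ 1 := by
      refine not_lt.mp fun hlt ↦ hx.2 (Or.inr ?_)
      exact ⟨⟨(x : E4), show (0 : ℝ) < (x : E4) 0 from zero_lt_one.trans hlt⟩, hlt, rfl⟩
    refine LorentzianMetric.causalFuture_mono ?_ (mem_causalPast_slab_of_time_le hfut hx0 hxle)
    intro z hz
    change U at z
    have hz' : (z : E4) 0 = 1 := hz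
    exact Or.inr ⟨⟨(z : E4), show (0 : ℝ) < (z : E4) 0 by rw [hz']; exact zero_lt_one⟩, hz', rfl⟩

/-- The charted late region of `subDecomp` is `{x⁰ > 1}` (as a set of points of `U`). -/
theorem charted_subDecomp (hfut : {x : E4 | 0 ≤ x 0} ⊆ (U : Set E4)) :
    (subDecomp (hU := hU) (hsl := hsl) (hC := hC) hfut).charted = {z : U | 1 < (z : E4) 0} := by
  refine Set.ext fun (z : U) ↦ ?_
  rw [FinalStateDecomposition.charted, FinalStateDecomposition.radiationZone]
  constructor
  · rintro (⟨y, hy, rfl⟩ | ⟨_, ⟨i, rfl⟩, _⟩)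
    · exact hy
    · exact i.elim0
  · intro hz
    exact Or.inl ⟨⟨(z : E4), show (0 : ℝ) < (z : E4) 0 from zero_lt_one.trans hz⟩, hz, rfl⟩

/-- **`O = {x⁰ ≥ 0}` is the self-determined exterior `J⁺(ι ℝ³) ∩ I⁻(charted)` of `η|_U`** (causal
relations within `U`: `mem_causalFuture_range_of_time_nonneg`, `mem_chronologicalPast_late_of_time_nonneg`,
`time_nonneg_of_mem_causalFuture_range`). [cite: DafermosLuk2017, Conjecture 1] -/
theorem futureSet_eq_exteriorOf (hfut : {x : E4 | 0 ≤ x 0} ⊆ (U : Set E4)) :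
    futureSet U = _root_.Summit.FinalStateConjecture.exteriorOf (subDev U hU hsl hC).toCauchyDevelopment
      (subDecomp (hU := hU) (hsl := hsl) (hC := hC) hfut).charted := by
  rw [charted_subDecomp]
  refine Set.ext fun (x : U) ↦ ?_
  constructor
  · intro hx
    exact ⟨mem_causalFuture_range_of_time_nonneg hfut hx, mem_chronologicalPast_late_of_time_nonneg hfut hx 1⟩
  · intro hx
    exact time_nonneg_of_mem_causalFuture_range hx.1

/-- **The inclusion chart exhausts `O`**: for every `τ₁ > 1`, a point of `O` not flat-late after `τ₁` has
`0 ≤ x⁰ ≤ τ₁` and lies in the causal past, within `U`, of the certified slab `{x⁰ = τ₁}`; the near-zone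
clause is vacuous (`N = 0`). [cite: DafermosLuk2017, Conjecture 1 (b)–(c)] -/
theorem hasExhaustiveCharts_subDecomp (hfut : {x : E4 | 0 ≤ x 0} ⊆ (U : Set E4)) :
    _root_.Summit.FinalStateConjecture.HasExhaustiveCharts
      (subDecomp (hU := hU) (hsl := hsl) (hC := hC) hfut) := by
  refine ⟨Fin.elim0, fun i ↦ i.elim0, fun i ↦ i.elim0, ?_⟩
  rintro τ₁ (hτ₁ : (1 : ℝ) < τ₁) x hx
  change U at x
  have hx0 : (0 : ℝ) ≤ (x : E4) 0 := hx.1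
  have hxle : (x : E4) 0 ≤ τ₁ := by
    refine not_lt.mp fun hlt ↦ hx.2 (Or.inl ?_)
    exact ⟨⟨(x : E4), show (0 : ℝ) < (x : E4) 0 from zero_lt_one.trans (hτ₁.trans hlt)⟩, hlt, rfl⟩
  refine LorentzianMetric.causalFuture_mono ?_ (mem_causalPast_slab_of_time_le hfut hx0 hxle)
  intro z hz
  change U at z
  have hz' : (z : E4) 0 = τ₁ := hz
  exact Or.inl ⟨⟨(z : E4), show (0 : ℝ) < (z : E4) 0 by rw [hz']; exact zero_lt_one.trans hτ₁⟩, hz', rfl⟩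

/-- **If `{x⁰ ≥ 0} ⊆ U`, the sub-development `η|_U` SETTLES**: it admits an honest (`O = exteriorOf`)
exhaustive final-state `2`-decomposition (`N = 0`). [cite: ChristodoulouKlainerman1993, Thm. 1.0.2] -/
theorem settles_of_future_subset (hfut : {x : E4 | 0 ≤ x 0} ⊆ (U : Set E4)) :
    ∃ (O : Set (subDev U hU hsl hC).carrier) (d : FinalStateDecomposition (subDev U hU hsl hC).toSpacetime O 2),
      O = _root_.Summit.FinalStateConjecture.exteriorOf (subDev U hU hsl hC).toCauchyDevelopment d.charted ∧
        _root_.Summit.FinalStateConjecture.HasExhaustiveCharts d :=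
  ⟨futureSet U, subDecomp hfut, futureSet_eq_exteriorOf hfut, hasExhaustiveCharts_subDecomp hfut⟩

/-- **Φ WITHOUT `IsMaximal` HOLDS ON THE FLAT MODEL CLASS — from completeness alone.** Every open
sub-development `η|_U` of the trivial datum (any open connected `U ⊇ {x⁰ = 0}` in which the slice is a
Cauchy hypersurface; maximal or — as all of them but `(ℝ⁴, η)` — not) whose future null infinity is
complete in the sojourn sense admits an honest exhaustive final-state `2`-decomposition: completeness
forces `{x⁰ ≥ 0} ⊆ U` (`hasCompleteNullInfinity_iff_future_subset`) and the future half-space settles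
(`settles_of_future_subset`). So `Disproof.TameResolutionWithoutMaximal` (Φ with `IsMaximal` deleted) is
true on every model the tree can certify, its hypotheses (i), (ii) being idle there as well, while Φ with
BOTH `IsMaximal` and completeness deleted is false on the same class (`not_tameResolution_allDevelopments`):
on the certifiable class, complete `𝓘⁺` is exactly the load-bearing structural hypothesis of K2R ≡ Φ.
[cite: Christodoulou1999, pp. A26–A27] -/
theorem settles_of_hasCompleteNullInfinity
    (h : _root_.Summit.FinalStateConjecture.HasCompleteNullInfinity (subDev U hU hsl hC).toCauchyDevelopment) :
    ∃ (O : Set (subDev U hU hsl hC).carrier) (d : FinalStateDecomposition (subDev U hU hsl hC).toSpacetime O 2),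
      O = _root_.Summit.FinalStateConjecture.exteriorOf (subDev U hU hsl hC).toCauchyDevelopment d.charted ∧
        _root_.Summit.FinalStateConjecture.HasExhaustiveCharts d :=
  settles_of_future_subset (hasCompleteNullInfinity_iff_future_subset.1 h)

end Decomposition

end Summit.FinalStateConjecture.FinalStateConjecture.Theorems.ChannelsResolveTameDevelopmentsR.SubMinkowski

end
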